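import Summits.AtomisticToContinuum.Crystallization.Theses.PricedLinkCensus
import Summits.AtomisticToContinuum.Crystallization.Theorems.ChargedEnergyGap.Negative.PeriodicForm
import Summits.AtomisticToContinuum.Crystallization.Theorems.TruncatedCensusGap.Negative.KappaZeroHalf

/-!
# Periodic pricing implies `TruncatedCensusGap` (the range-2 truncated potential `V_χ`)

Stub `truncatedCensusGap_of_periodicPricing` (PERIODIC PRICING ⇒ CRUX) of the line
`sharp-m-potential-compactness` for the crux `PricedLinkCensus.TruncatedCensusGap`
(item stmt-AtomisticToContinuum-14230).

The crux is, by definition, `∃ κ > 0, ∀ N (y : Fin N → ℝ³) injective,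
N·e_χ* + κ·#(charged sites of y) ≤ E_χ(y)` with `V_χ r = min 1 (max 0 (4 - 2r)) · V_LJ r` (range
`2`) and `e_χ* = ⨅_Q e_χ(Q)` over periodic configurations.  The hypothesis is its PERIODIC form:
every periodic `Q` pays `κ` per charged motif site above `e_χ*`
(`ChargedEnergyGapNegative.motifCharged`).  This is the `V_χ` twin of the Lennard-Jones theorem
`ChargedEnergyGapNegative.noBoundary_of_periodicPricing`, with a simpler energy step: periodise
`y` with the LARGE cubic period `8D + 8` (`ChargedEnergyGapNegative.periodiseFar`); the charged
motif sites are exactly the charged sites of `y` (`motifCharged_periodiseFar`, potential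
independent), and since `V_χ` vanishes on `[2, ∞)` while distinct copies are more than
`(diameter of y) + 8` apart, the energy per particle of the periodisation is EXACTLY `E_χ(y)/N`
(`energyPerParticle_eq_div_of_motif_eq`).  The cases `N ≤ 1` follow from the dimer instance
`2 e_χ* + 2κ ≤ -1/12` of the case `N = 2`.
-/

noncomputable section

namespace Summit.AtomisticToContinuum.Crystallization.Theorems.PricedLinkCensusTruncatedCensusGap

open Literature.MathematicalPhysics.StatisticalMechanics Literature.Geometry.DiscreteGeometry
open Summit.AtomisticToContinuum.Crystallization.Theorems.ChargedEnergyGapNegative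

/-- Non-zero periods of the far periodisation `y + (8D+8)ℤ³` are longer than
`(any mutual distance of y) + 8`. [folklore] -/
theorem norm_sub_add_le_norm_of_mem_lattice_periodiseFar {N : ℕ} (y : Fin N → E3) (hN : 0 < N)
    {g : E3} (hg : g ∈ (periodiseFar y hN).lattice) (hg0 : g ≠ 0) (i j : Fin N) :
    ‖y i - y j‖ + 8 ≤ ‖g‖ := by
  have hpos : 0 < (spacingUnit y : ℝ) := by
    rw [val_spacingUnit]; unfold spacing; linarith [Dsum_nonneg y]
  have h1 : (spacingUnit y : ℝ) ≤ ‖g‖ := le_norm_of_mem_cubicLattice hpos hg hg0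
  rw [val_spacingUnit] at h1
  unfold spacing at h1
  have h2 : ‖y i - y j‖ ≤ 2 * Dsum y := by rw [← dist_eq_norm]; exact dist_le_two_Dsum y i j
  linarith [Dsum_nonneg y]

/-- **Finite-range energy of the far periodisation.** For a pair potential vanishing on `[R, ∞)`
with `R ≤ 8` and an injective `y`, the far periodisation has energy per particle EXACTLY
`E(y)/N`. [folklore] -/
theorem energyPerParticle_periodiseFar_eq_div {V : ℝ → ℝ} {R : ℝ} (hV : ∀ r, R ≤ r → V r = 0)
    (hR : R ≤ 8) {N : ℕ} {y : Fin N → E3} (hy : Function.Injective y) (hN : 0 < N) :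
    (periodiseFar y hN).energyPerParticle V = interactionEnergy V y / N :=
  energyPerParticle_eq_div_of_motif_eq hV hy (periodiseFar y hN) (motif_periodiseFar y hN)
    fun g hg hg0 i j => by
      linarith [norm_sub_add_le_norm_of_mem_lattice_periodiseFar y hN hg hg0 i j]

/-- **Periodic pricing for `V_χ` implies `TruncatedCensusGap`.**  If every periodic configuration
pays `κ > 0` per charged motif site (tolerance `1/100`) above `e_χ*`, then every finite injective
configuration `y` satisfies `N·e_χ* + κ·#charged(y) ≤ E_χ(y)` (far periodisation for `N ≥ 2`; the
dimer instance `e_χ* + κ ≤ -1/24` settles `N ≤ 1`). [folklore] -/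
theorem truncatedCensusGap_of_periodicPricing : (∃ κ : ℝ, 0 < κ ∧ ∀ Q : PeriodicConfiguration 3, κ * (Summit.AtomisticToContinuum.Crystallization.Theorems.ChargedEnergyGapNegative.motifCharged (1 / 100) Q : ℝ) ≤ (Q.motif.card : ℝ) * (Q.energyPerParticle (fun r => min 1 (max 0 (4 - 2 * r)) * lennardJones r) - ⨅ Q' : PeriodicConfiguration 3, Q'.energyPerParticle (fun r => min 1 (max 0 (4 - 2 * r)) * lennardJones r))) → Summit.AtomisticToContinuum.Crystallization.Theses.PricedLinkCensus.TruncatedCensusGap := by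
  rintro ⟨κ, hκ, h⟩
  -- `N ≥ 2`: the far periodisation
  have main : ∀ {N : ℕ}, 2 ≤ N → ∀ (y : Fin N → E3), Function.Injective y →
      (N : ℝ) * (⨅ Q : PeriodicConfiguration 3,
          Q.energyPerParticle (fun r => min 1 (max 0 (4 - 2 * r)) * lennardJones r)) +
        κ * (charged (1 / 100) y : ℝ) ≤
        interactionEnergy (fun r => min 1 (max 0 (4 - 2 * r)) * lennardJones r) y := by
    intro N hN y hy
    have hN0 : 0 < N := by omega
    have hN2 : ∀ i : Fin N, ∃ j, j ≠ i := exists_ne_of_two_le hN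
    have hp := h (periodiseFar y hN0)
    rw [motifCharged_periodiseFar hy hN0 (by norm_num) hN2] at hp
    have hcard : (((periodiseFar y hN0).motif.card : ℕ) : ℝ) = N := by
      rw [motif_periodiseFar, Finset.card_image_of_injective _ hy, Finset.card_univ,
        Fintype.card_fin]
    have he : (periodiseFar y hN0).energyPerParticle
        (fun r => min 1 (max 0 (4 - 2 * r)) * lennardJones r) =
        interactionEnergy (fun r => min 1 (max 0 (4 - 2 * r)) * lennardJones r) y / N :=
      energyPerParticle_periodiseFar_eq_div truncLJ_eq_zero_of_two_le (by norm_num) hy hN0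
    rw [hcard, he, mul_sub] at hp
    have hNr : (0 : ℝ) < N := by exact_mod_cast hN0
    have hmul : (N : ℝ) *
        (interactionEnergy (fun r => min 1 (max 0 (4 - 2 * r)) * lennardJones r) y / N) =
        interactionEnergy (fun r => min 1 (max 0 (4 - 2 * r)) * lennardJones r) y := by
      field_simp
    linarith
  -- the dimer instance: `e_χ* + κ ≤ -1/24`
  have hdimer : (⨅ Q : PeriodicConfiguration 3,
      Q.energyPerParticle (fun r => min 1 (max 0 (4 - 2 * r)) * lennardJones r)) + κ ≤
        -1 / 24 := by
    have h2 := main le_rfl _ injective_pair_zero_single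
    rw [charged_eq_of_le (by norm_num)
      ![(0 : EuclideanSpace ℝ (Fin 3)), EuclideanSpace.single 0 1],
      interactionEnergy_truncLJ_pair] at h2
    push_cast at h2
    linarith
  refine ⟨κ, hκ, fun N y hy => ?_⟩
  show (N : ℝ) * _ + κ * (charged (1 / 100) y : ℝ) ≤ _
  rcases Nat.lt_or_ge N 2 with hN | hN
  · interval_cases N
    · rw [charged_zero, interactionEnergy_of_subsingleton]
      simp
    · rw [charged_eq_of_le (by norm_num) y, interactionEnergy_of_subsingleton]
      push_cast
      linarith
  · exact main hN y hy

end Summit.AtomisticToContinuum.Crystallization.Theorems.PricedLinkCensusTruncatedCensusGap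

end
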